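import Summits.ResolutionOfSingularities.ResolutionOfSingularities.Theorems.HomologicalConductorNoZenoRJacobianFloorNormal
import Summits.ResolutionOfSingularities.ResolutionOfSingularities.Theorems.HomologicalConductorNoZenoKaehlerDifferentFloor
import HarnessLib

/-!
# Crux `NoZenoR` (stmt-ResolutionOfSingularities-19943): the Kähler-different floor for NORMAL domains of
# dimension `≤ 3` over a Noether normalisation, uniformly; normal surfaces are projective over the base

Route `ResolutionOfSingularities/HomologicalConductor` (cell decomp-res, hand leafhand-res-homologicalconduct-16 g1).
OURS: AI-written, weaker than expert review; nothing here is a statement of the manuscript under review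
(Hironaka 2017).  SUPPORT level, counted 0.  Def-free; no new named facts.

Companions of `…JacobianFloorNormal.jacobianFloorNN_normal_dim3_holds` (Iyengar–Takahashi 2016 Thm 3.8 for normal
threefolds), in the setting of the named fact (a NORMAL domain `B` — noetherianity of `B` is not needed —, module-finite over a noetherian `A`
along an injective structure map, with `∃ n, caⁿ(A) = A`):

* `isRegularRing_of_exists_cohomologyAnnihilatorOfDegree_eq_top` — such an `A` is a regular ring (`caⁿ(A) = A`
  localises, tree Lemma 2.10(1); a noetherian local ring with `caⁿ = (1)` is regular, tree / Serre);
* `projective_of_isIntegrallyClosed_of_ringKrullDim_le_two` — **in dimension `≤ 2` the normal domain `B` is a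
  PROJECTIVE `A`-module** («normal surfaces are Cohen–Macaulay, hence free over a Noether normalisation»): `B` is
  reflexive (`isReflexive_of_isIntegrallyClosed`) and `ca³(A) = A`, so `pd_A B ≤ 0`;
* `noetherDifferent_le_cohomologyAnnihilatorOfDegree_of_isIntegrallyClosed` — `𝔑(B/A) ⊆ ca^{d+1}(B)` for
  `d = dim B ≤ 3` (projective case `d ≤ 2`: tree Prop. 3.4; `d = 3`: the torsion-free / `pd ≤ 1` floor);
* `fittingIdeal_kaehlerDifferential_le_cohomologyAnnihilatorOfDegree_of_isIntegrallyClosed` — the KÄHLER-DIFFERENT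
  FLOOR `Fitt₀(Ω[B⁄A]) ≤ ca^{d+1}(B)` for every normal domain `B` of dimension `d ≤ 3` and every Noether
  normalisation (Iyengar–Takahashi 2016 Thm 3.8, one summand, in every dimension where a normal domain satisfies
  `2·depth ≥ dim` automatically).
-/

noncomputable section

-- single-problem summit: the doubled namespace component `ResolutionOfSingularities` is forced
set_option linter.dupNamespace false

open CategoryTheory CategoryTheory.Abelian Module
open Literature.RingTheory.CohomologyAnnihilator
open Summit.ResolutionOfSingularities.ResolutionOfSingularities.Theorems.HomologicalConductor

universe u

namespace Summit.ResolutionOfSingularities.ResolutionOfSingularities.Theorems.NoZeno.JacobianFloorNormal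

variable {A : Type u} [CommRing A] [IsNoetherianRing A]

/-- A noetherian ring with `caⁿ(A) = A` for some `n` is regular: `caⁿ` passes to localisations
(Iyengar–Takahashi 2014, Lemma 2.10(1)), and a noetherian local ring with `caⁿ = (1)` is regular
(Example 2.5 + Auslander–Buchsbaum–Serre). [cite: IyengarTakahashi2014, Lemma 2.10 and Example 2.5] -/
theorem isRegularRing_of_exists_cohomologyAnnihilatorOfDegree_eq_top
    (hn : ∃ n : ℕ, cohomologyAnnihilatorOfDegree A n = ⊤) : IsRegularRing A := by
  obtain ⟨n, hn⟩ := hn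
  refine isRegularRing_iff.mpr fun p _ => ?_
  refine isRegularLocalRing_of_cohomologyAnnihilatorOfDegree_eq_top (n := n) (top_le_iff.mp ?_)
  calc (⊤ : Ideal (Localization.AtPrime p))
      = (cohomologyAnnihilatorOfDegree A n).map (algebraMap A (Localization.AtPrime p)) := by
        rw [hn, Ideal.map_top]
    _ ≤ cohomologyAnnihilatorOfDegree (Localization.AtPrime p) n :=
        map_cohomologyAnnihilatorOfDegree_le_of_isLocalization p.primeCompl (Localization.AtPrime p) n

variable {B : Type u} [CommRing B] [IsDomain B] [Algebra A B] [Module.Finite A B]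

omit [IsDomain B] in
/-- In the setting of the named fact, `ca^{d+1}(A) = A` for `d = dim B` (`A` is regular of dimension
`dim A = dim B`). [this work; plumbing over tree results] -/
theorem cohomologyAnnihilatorOfDegree_base_eq_top (hinj : Function.Injective (algebraMap A B))
    (hn : ∃ n : ℕ, cohomologyAnnihilatorOfDegree A n = ⊤) {d : ℕ} (hdim : ringKrullDim B ≤ d) :
    cohomologyAnnihilatorOfDegree A (d + 1) = ⊤ := by
  haveI : IsRegularRing A := isRegularRing_of_exists_cohomologyAnnihilatorOfDegree_eq_top hn
  have hdimA : ringKrullDim A ≤ d := by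
    rw [← Literature.AlgebraicGeometry.Resolution.ringKrullDim_eq_of_isIntegral (R := A) (S := B) hinj]
    exact hdim
  exact cohomologyAnnihilatorOfDegree_eq_top_of_isRegularRing A hdimA

variable [IsIntegrallyClosed B]

/-- **Normal surfaces are projective over a Noether normalisation.**  A noetherian NORMAL domain `B` of
Krull dimension `≤ 2`, module-finite over a noetherian `A` along an injective structure map with
`∃ n, caⁿ(A) = A` (i.e. `A` regular), is a projective `A`-module: `B` is reflexive
(`isReflexive_of_isIntegrallyClosed`) and `ca³(A) = A`, so `pd_A B ≤ 3 − 2 − 1 = 0`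
(`hasProjectiveDimensionLT_of_isReflexive`). [this work; cf. BrunsHerzog1998 Prop. 1.4.1, Thm. 2.2.7] -/
theorem projective_of_isIntegrallyClosed_of_ringKrullDim_le_two
    (hinj : Function.Injective (algebraMap A B)) (hn : ∃ n : ℕ, cohomologyAnnihilatorOfDegree A n = ⊤)
    (hdim : ringKrullDim B ≤ 2) : Module.Projective A B := by
  haveI : IsDomain A := Function.Injective.isDomain (algebraMap A B) hinj
  haveI : FaithfulSMul A B := (faithfulSMul_iff_algebraMap_injective A B).mpr hinj
  have hA3 : cohomologyAnnihilatorOfDegree A 3 = ⊤ := cohomologyAnnihilatorOfDegree_base_eq_top hinj hn hdim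
  haveI : Module.IsReflexive A B := isReflexive_of_isIntegrallyClosed
  haveI : HasProjectiveDimensionLT (ModuleCat.of A B) 1 :=
    hasProjectiveDimensionLT_of_isReflexive (n := 0) hA3 B
  have : Projective (ModuleCat.of A B) := inferInstance
  exact (ModuleCat.of A B).projective_of_module_projective

/-- **`𝔑(B/A) ⊆ ca^{d+1}(B)` for normal domains of dimension `d ≤ 3` over a Noether normalisation**: for
`d ≤ 2` the algebra is projective (`projective_of_isIntegrallyClosed_of_ringKrullDim_le_two`) and Iyengar–Takahashi
2014 Prop. 3.4 applies (tree, projective case); for `d = 3` it is reflexive of projective dimension `≤ 1` and the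
torsion-free floor `NoetherDifferentTorsionFree.noetherDifferent_le_cohomologyAnnihilatorOfDegree_of_hasProjectiveDimensionLT_two`
applies. [this work; cf. IyengarTakahashi2016 Thm 3.8] -/
theorem noetherDifferent_le_cohomologyAnnihilatorOfDegree_of_isIntegrallyClosed
    (hinj : Function.Injective (algebraMap A B)) (hn : ∃ n : ℕ, cohomologyAnnihilatorOfDegree A n = ⊤)
    {d : ℕ} (hdim : ringKrullDim B = d) (hd : d ≤ 3) :
    noetherDifferent A B ≤ cohomologyAnnihilatorOfDegree B (d + 1) := by
  haveI : IsDomain A := Function.Injective.isDomain (algebraMap A B) hinj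
  haveI : FaithfulSMul A B := (faithfulSMul_iff_algebraMap_injective A B).mpr hinj
  have hAd : cohomologyAnnihilatorOfDegree A (d + 1) = ⊤ := cohomologyAnnihilatorOfDegree_base_eq_top hinj hn hdim.le
  rcases Nat.lt_or_ge d 3 with hlt | hge
  · -- `d ≤ 2`: `B` is projective over `A`
    haveI : Module.Projective A B :=
      projective_of_isIntegrallyClosed_of_ringKrullDim_le_two hinj hn
        (hdim.le.trans (by exact_mod_cast (by omega : d ≤ 2)))
    exact PersistenceFrobeniusDifferent.noetherDifferent_le_cohomologyAnnihilatorOfDegree_of_projective hAd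
  · -- `d = 3`: reflexive of projective dimension `≤ 1`
    obtain rfl : d = 3 := le_antisymm hd hge
    haveI : NoZeroSMulDivisors A B := ⟨fun {a b} h => by
      rw [Algebra.smul_def, mul_eq_zero] at h
      exact h.imp_left fun ha => hinj (by rw [ha, map_zero])⟩
    haveI : Module.IsReflexive A B := isReflexive_of_isIntegrallyClosed
    haveI : HasProjectiveDimensionLT (ModuleCat.of A B) 2 := hasProjectiveDimensionLT_of_isReflexive hAd B
    let e : B ≃ₗ[A] (restrictScalarsFunctor A B).obj (ModuleCat.of B B) :=
      { toFun := fun b => b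
        invFun := fun b => b
        map_add' := fun _ _ => rfl
        map_smul' := fun a b => Algebra.smul_def a b
        left_inv := fun _ => rfl
        right_inv := fun _ => rfl }
    have hpd : HasProjectiveDimensionLT ((restrictScalarsFunctor A B).obj (ModuleCat.of B B)) 2 :=
      hasProjectiveDimensionLT_of_iso e.toModuleIso 2
    exact NoetherDifferentTorsionFree.noetherDifferent_le_cohomologyAnnihilatorOfDegree_of_hasProjectiveDimensionLT_two
      hpd (d := 3) (by norm_num) hAd

/-- **THE KÄHLER-DIFFERENT FLOOR for normal domains of dimension `≤ 3`** (Iyengar–Takahashi 2016 Thm 3.8, one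
summand of `jac`, uniformly in every dimension `d ≤ 3`): for a noetherian normal domain `B` of Krull dimension
`d ≤ 3` and every Noether normalisation `A → B` (`A` noetherian, `∃ n, caⁿ(A) = A`, `B` module-finite, `A → B`
injective): `Fitt₀(Ω[B⁄A]) ≤ ca^{d+1}(B)` — the Kähler different lies in the Noether different (Scheja–Storch, tree)
which lies in `ca^{d+1}(B)`. [this work; cf. IyengarTakahashi2016 Thm 3.8] -/
theorem fittingIdeal_kaehlerDifferential_le_cohomologyAnnihilatorOfDegree_of_isIntegrallyClosed
    (hinj : Function.Injective (algebraMap A B)) (hn : ∃ n : ℕ, cohomologyAnnihilatorOfDegree A n = ⊤)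
    {d : ℕ} (hdim : ringKrullDim B = d) (hd : d ≤ 3) :
    Literature.RingTheory.FittingIdeal.Module.fittingIdeal B (Ω[B⁄A]) 0 ≤ cohomologyAnnihilatorOfDegree B (d + 1) :=
  fittingIdeal_kaehlerDifferential_le_noetherDifferent.trans
    (noetherDifferent_le_cohomologyAnnihilatorOfDegree_of_isIntegrallyClosed hinj hn hdim hd)

end Summit.ResolutionOfSingularities.ResolutionOfSingularities.Theorems.NoZeno.JacobianFloorNormal

end
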